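import Summits.CriticalPhenomena.PercolationContinuityZ3.Theorems.PercNearOneGluingNoHeavyLowerTailCubicFourPointL1PendantB
import Summits.CriticalPhenomena.PercolationContinuityZ3.Theorems.PercNearOneGluingNoHeavyLowerTailCubicThreePointGluingCells
import Mathlib.Tactic.Ring
import Mathlib.Tactic.Linarith
import HarnessLib

/-!
# `NoHeavyLowerTail` (stmt-CriticalPhenomena-4575) — (L1) on forests, preparation at GRAPH level:
# the consistency relations (R1), (R2) of `massesW` and the `b`-isolated law `= isoB`

Support file (prover prim-l12-p2, `--supports stmt-CriticalPhenomena-4575`).  No sorries, no definitions, no named facts.  Weighted-cube calculus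
of `…CubicThreePointSections` / `…GluingCells` (`R`, `PrW`, `ind`, `eq_of_R_of_avoids`) and the masses `CubicFourPointL1.massesW` of `…CubicFourPointL1Step`.

These are the graph-level inputs of the mass-level pendant-`b` theorem `HybMasses.L1_mix_isoB_nonneg` (`…CubicFourPointL1PendantB`):
* `massesW_R1`: `ac − bc_ac − ac_gb + bc_ac_gb = β` — pointwise, `{a≁c} ∖ {b≁c} = {a≁c, b~c}` and removing `{b≁a, b≁y}` from it leaves exactly the
  cell `a|bcy` (transitivity of `~` twice);
* `massesW_R2`: `gc − bc_gc − gc_ab + bc_gc_ab = 0` — `{c≁a, c≁y, b~c, a~b}` is empty;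
* `massesW_isoB`: if `b` lies on no edge of `D ∪ K` (and `b ≠ a, c, y`), the masses of `(a,b,c,y)` are `isoB` of themselves (every separation
  involving `b` is certain, `β = 0`).
With `CubicFourPointL1.massesW_insert` (one-edge split) the remaining steps of "(L1) on every forest" (seat memo MEMO-P2-DC.md §6) are: the leaf
identification `massesW D' p (insert e K) a b c y = ` masses of `(a,u,c,y)`, Harris for the two pairs, and the tree induction.
[cite: Grimmett1999, §2.2 (product measure on disjoint edge sets; Harris–FKG)]; [cite: GladkovZimin2024HK, §4 (one-edge decomposition)]
-/

noncomputable section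

namespace Summit.CriticalPhenomena.PercolationContinuityZ3.Theorems

namespace CubicFourPointL1

open Finset SimpleGraph Literature.Probability.Percolation.DecisionTree CubicThreePointStep TerminalGluing

variable {V : Type*} [DecidableEq V]

/-- A five-term linear relation of masses from a pointwise indicator identity. [folklore] -/
theorem PrW_of_ind_add_eq_add3 (D : Finset (Sym2 V)) (p : Sym2 V → ℝ) {A B C E G : Set (Finset (Sym2 V))}
    (h : ∀ S, S ⊆ D → ind A S + ind B S = ind C S + ind E S + ind G S) :
    PrW D p A + PrW D p B = PrW D p C + PrW D p E + PrW D p G := by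
  rw [PrW_eq_sum_ind, PrW_eq_sum_ind, PrW_eq_sum_ind, PrW_eq_sum_ind, PrW_eq_sum_ind, ← Finset.sum_add_distrib,
    ← Finset.sum_add_distrib, ← Finset.sum_add_distrib]
  exact Finset.sum_congr rfl fun S hS => by
    have := h S (Finset.mem_powerset.1 hS)
    have e : wtW D p S * ind A S + wtW D p S * ind B S = wtW D p S * (ind A S + ind B S) := by ring
    rw [e, this]; ring

/-- **(R1)** `ac − bc_ac − ac_gb + bc_ac_gb = β` for the masses of any `(D, p, K, a, b, c, y)`. [folklore] -/
theorem massesW_R1 (D : Finset (Sym2 V)) (p : Sym2 V → ℝ) (K : Finset (Sym2 V)) (a b c y : V) :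
    (massesW D p K a b c y).ac - (massesW D p K a b c y).bc_ac - (massesW D p K a b c y).ac_gb
      + (massesW D p K a b c y).bc_ac_gb = (massesW D p K a b c y).β := by
  have key : PrW D p (sep K a c) + PrW D p ((sep K b c ∩ sep K a c) ∩ (sep K a b ∩ sep K b y))
      = PrW D p (cellA K a b c y) + PrW D p (sep K b c ∩ sep K a c) + PrW D p (sep K a c ∩ (sep K a b ∩ sep K b y)) := by
    refine PrW_of_ind_add_eq_add3 D p fun S _ => ?_
    by_cases hac : R K S a c
    · have n1 : S ∉ sep K a c := fun h => (mem_sep _ _ _ _).1 h hac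
      rw [ind_of_not_mem n1,
        ind_of_not_mem (fun h : S ∈ (sep K b c ∩ sep K a c) ∩ (sep K a b ∩ sep K b y) => (mem_sep _ _ _ _).1 h.1.2 hac),
        ind_of_not_mem (fun h : S ∈ sep K b c ∩ sep K a c => (mem_sep _ _ _ _).1 h.2 hac),
        ind_of_not_mem (fun h : S ∈ sep K a c ∩ (sep K a b ∩ sep K b y) => (mem_sep _ _ _ _).1 h.1 hac)]
      by_cases hcell : S ∈ cellA K a b c y
      · exact absurd (hac.trans hcell.2.1.symm) hcell.1
      · rw [ind_of_not_mem hcell]; ring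
    · have y1 : S ∈ sep K a c := hac
      rw [ind_of_mem y1]
      by_cases hbc : R K S b c
      · have hab : ¬ R K S a b := fun h => hac (h.trans hbc)
        rw [ind_of_not_mem (fun h : S ∈ (sep K b c ∩ sep K a c) ∩ (sep K a b ∩ sep K b y) => (mem_sep _ _ _ _).1 h.1.1 hbc),
          ind_of_not_mem (fun h : S ∈ sep K b c ∩ sep K a c => (mem_sep _ _ _ _).1 h.1 hbc)]
        by_cases hby : R K S b y
        · rw [ind_of_mem (show S ∈ cellA K a b c y from ⟨hab, hbc, hby⟩),
            ind_of_not_mem (fun h : S ∈ sep K a c ∩ (sep K a b ∩ sep K b y) => (mem_sep _ _ _ _).1 h.2.2 hby)]; ring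
        · rw [ind_of_not_mem (fun h : S ∈ cellA K a b c y => hby h.2.2),
            ind_of_mem (show S ∈ sep K a c ∩ (sep K a b ∩ sep K b y) from ⟨hac, hab, hby⟩)]; ring
      · rw [ind_of_not_mem (fun h : S ∈ cellA K a b c y => hbc h.2.1),
          ind_of_mem (show S ∈ sep K b c ∩ sep K a c from ⟨hbc, hac⟩)]
        by_cases hg : S ∈ sep K a b ∩ sep K b y
        · rw [ind_of_mem (show S ∈ (sep K b c ∩ sep K a c) ∩ (sep K a b ∩ sep K b y) from ⟨⟨hbc, hac⟩, hg⟩),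
            ind_of_mem (show S ∈ sep K a c ∩ (sep K a b ∩ sep K b y) from ⟨hac, hg⟩)]; ring
        · rw [ind_of_not_mem (fun h : S ∈ (sep K b c ∩ sep K a c) ∩ (sep K a b ∩ sep K b y) => hg h.2),
            ind_of_not_mem (fun h : S ∈ sep K a c ∩ (sep K a b ∩ sep K b y) => hg h.2)]; ring
  simp only [massesW]
  linarith

/-- **(R2)** `gc − bc_gc − gc_ab + bc_gc_ab = 0` for the masses of any `(D, p, K, a, b, c, y)`. [folklore] -/
theorem massesW_R2 (D : Finset (Sym2 V)) (p : Sym2 V → ℝ) (K : Finset (Sym2 V)) (a b c y : V) :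
    (massesW D p K a b c y).gc - (massesW D p K a b c y).bc_gc - (massesW D p K a b c y).gc_ab
      + (massesW D p K a b c y).bc_gc_ab = 0 := by
  have key : PrW D p (sep K a c ∩ sep K c y) + PrW D p ((sep K b c ∩ (sep K a c ∩ sep K c y)) ∩ sep K a b)
      = PrW D p (∅ : Set (Finset (Sym2 V))) + PrW D p (sep K b c ∩ (sep K a c ∩ sep K c y))
        + PrW D p ((sep K a c ∩ sep K c y) ∩ sep K a b) := by
    refine PrW_of_ind_add_eq_add3 D p fun S _ => ?_
    rw [ind_of_not_mem (Set.notMem_empty S)]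
    by_cases hg : S ∈ sep K a c ∩ sep K c y
    · rw [ind_of_mem hg]
      by_cases hbc : R K S b c
      · have hab : ¬ R K S a b := fun h => (mem_sep _ _ _ _).1 hg.1 (h.trans hbc)
        rw [ind_of_not_mem (fun h : S ∈ (sep K b c ∩ (sep K a c ∩ sep K c y)) ∩ sep K a b => (mem_sep _ _ _ _).1 h.1.1 hbc),
          ind_of_not_mem (fun h : S ∈ sep K b c ∩ (sep K a c ∩ sep K c y) => (mem_sep _ _ _ _).1 h.1 hbc),
          ind_of_mem (show S ∈ (sep K a c ∩ sep K c y) ∩ sep K a b from ⟨hg, hab⟩)]; ring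
      · rw [ind_of_mem (show S ∈ sep K b c ∩ (sep K a c ∩ sep K c y) from ⟨hbc, hg⟩)]
        by_cases hab : R K S a b
        · rw [ind_of_not_mem (fun h : S ∈ (sep K b c ∩ (sep K a c ∩ sep K c y)) ∩ sep K a b => (mem_sep _ _ _ _).1 h.2 hab),
            ind_of_not_mem (fun h : S ∈ (sep K a c ∩ sep K c y) ∩ sep K a b => (mem_sep _ _ _ _).1 h.2 hab)]; ring
        · rw [ind_of_mem (show S ∈ (sep K b c ∩ (sep K a c ∩ sep K c y)) ∩ sep K a b from ⟨⟨hbc, hg⟩, hab⟩),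
            ind_of_mem (show S ∈ (sep K a c ∩ sep K c y) ∩ sep K a b from ⟨hg, hab⟩)]; ring
    · rw [ind_of_not_mem hg,
        ind_of_not_mem (fun h : S ∈ (sep K b c ∩ (sep K a c ∩ sep K c y)) ∩ sep K a b => hg h.1.2),
        ind_of_not_mem (fun h : S ∈ sep K b c ∩ (sep K a c ∩ sep K c y) => hg h.2),
        ind_of_not_mem (fun h : S ∈ (sep K a c ∩ sep K c y) ∩ sep K a b => hg h.1)]; ring
  have e0 : PrW D p (∅ : Set (Finset (Sym2 V))) = 0 := PrW_eq_zero_of_forall D p fun S _ => Set.notMem_empty S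
  simp only [massesW]
  linarith

/-- **The `b`-isolated law is `isoB` of itself**: if `b` lies on no edge of `D ∪ K` and `b ∉ {a, c, y}`, every separation involving `b` is certain
and the cell `a|bcy` is empty. [folklore] -/
theorem massesW_isoB (D : Finset (Sym2 V)) (p : Sym2 V → ℝ) (K : Finset (Sym2 V)) {a b c y : V}
    (hb : ∀ e ∈ D ∪ K, b ∉ e) (hba : b ≠ a) (hbc : b ≠ c) (hby : b ≠ y) :
    massesW D p K a b c y = HybMasses.isoB (massesW D p K a b c y) := by
  have nb : ∀ S, S ⊆ D → ∀ x, x ≠ b → ¬ R K S b x := fun S hS x hx h => hx (eq_of_R_of_avoids hS hb h).symm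
  have nab : ∀ S, S ⊆ D → ¬ R K S a b := fun S hS h => hba (eq_of_R_of_avoids hS hb h.symm)
  have sbc : ∀ S, S ⊆ D → S ∈ sep K b c := fun S hS => nb S hS c hbc.symm
  have sab : ∀ S, S ⊆ D → S ∈ sep K a b := fun S hS => nab S hS
  have sby : ∀ S, S ⊆ D → S ∈ sep K b y := fun S hS => nb S hS y hby.symm
  have e_bc : PrW D p (sep K b c) = 1 := PrW_eq_one_of_forall D p sbc
  have e_ab : PrW D p (sep K a b) = 1 := PrW_eq_one_of_forall D p sab
  have e_gb : PrW D p (sep K a b ∩ sep K b y) = 1 := PrW_eq_one_of_forall D p fun S hS => ⟨sab S hS, sby S hS⟩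
  have e_beta : PrW D p (cellA K a b c y) = 0 := PrW_eq_zero_of_forall D p fun S hS h => nb S hS c hbc.symm h.2.1
  have e_bc_ac : PrW D p (sep K b c ∩ sep K a c) = PrW D p (sep K a c) :=
    PrW_of_ind_eq D p fun S hS => by
      by_cases h : S ∈ sep K a c
      · rw [ind_of_mem (show S ∈ sep K b c ∩ sep K a c from ⟨sbc S hS, h⟩), ind_of_mem h]
      · rw [ind_of_not_mem (fun h' : S ∈ sep K b c ∩ sep K a c => h h'.2), ind_of_not_mem h]
  have e_bc_gb : PrW D p (sep K b c ∩ (sep K a b ∩ sep K b y)) = 1 :=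
    PrW_eq_one_of_forall D p fun S hS => ⟨sbc S hS, sab S hS, sby S hS⟩
  have e_ac_gb : PrW D p (sep K a c ∩ (sep K a b ∩ sep K b y)) = PrW D p (sep K a c) :=
    PrW_of_ind_eq D p fun S hS => by
      by_cases h : S ∈ sep K a c
      · rw [ind_of_mem (show S ∈ sep K a c ∩ (sep K a b ∩ sep K b y) from ⟨h, sab S hS, sby S hS⟩), ind_of_mem h]
      · rw [ind_of_not_mem (fun h' : S ∈ sep K a c ∩ (sep K a b ∩ sep K b y) => h h'.1), ind_of_not_mem h]
  have e_bc_ac_gb : PrW D p ((sep K b c ∩ sep K a c) ∩ (sep K a b ∩ sep K b y)) = PrW D p (sep K a c) :=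
    PrW_of_ind_eq D p fun S hS => by
      by_cases h : S ∈ sep K a c
      · rw [ind_of_mem (show S ∈ (sep K b c ∩ sep K a c) ∩ (sep K a b ∩ sep K b y) from ⟨⟨sbc S hS, h⟩, sab S hS, sby S hS⟩),
          ind_of_mem h]
      · rw [ind_of_not_mem (fun h' : S ∈ (sep K b c ∩ sep K a c) ∩ (sep K a b ∩ sep K b y) => h h'.1.2), ind_of_not_mem h]
  have e_bc_gc : PrW D p (sep K b c ∩ (sep K a c ∩ sep K c y)) = PrW D p (sep K a c ∩ sep K c y) :=
    PrW_of_ind_eq D p fun S hS => by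
      by_cases h : S ∈ sep K a c ∩ sep K c y
      · rw [ind_of_mem (show S ∈ sep K b c ∩ (sep K a c ∩ sep K c y) from ⟨sbc S hS, h⟩), ind_of_mem h]
      · rw [ind_of_not_mem (fun h' : S ∈ sep K b c ∩ (sep K a c ∩ sep K c y) => h h'.2), ind_of_not_mem h]
  have e_bc_ab : PrW D p (sep K b c ∩ sep K a b) = 1 := PrW_eq_one_of_forall D p fun S hS => ⟨sbc S hS, sab S hS⟩
  have e_gc_ab : PrW D p ((sep K a c ∩ sep K c y) ∩ sep K a b) = PrW D p (sep K a c ∩ sep K c y) :=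
    PrW_of_ind_eq D p fun S hS => by
      by_cases h : S ∈ sep K a c ∩ sep K c y
      · rw [ind_of_mem (show S ∈ (sep K a c ∩ sep K c y) ∩ sep K a b from ⟨h, sab S hS⟩), ind_of_mem h]
      · rw [ind_of_not_mem (fun h' : S ∈ (sep K a c ∩ sep K c y) ∩ sep K a b => h h'.1), ind_of_not_mem h]
  have e_bc_gc_ab : PrW D p ((sep K b c ∩ (sep K a c ∩ sep K c y)) ∩ sep K a b) = PrW D p (sep K a c ∩ sep K c y) :=
    PrW_of_ind_eq D p fun S hS => by
      by_cases h : S ∈ sep K a c ∩ sep K c y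
      · rw [ind_of_mem (show S ∈ (sep K b c ∩ (sep K a c ∩ sep K c y)) ∩ sep K a b from ⟨⟨sbc S hS, h⟩, sab S hS⟩), ind_of_mem h]
      · rw [ind_of_not_mem (fun h' : S ∈ (sep K b c ∩ (sep K a c ∩ sep K c y)) ∩ sep K a b => h h'.1.2), ind_of_not_mem h]
  simp only [massesW, HybMasses.isoB, e_bc, e_ab, e_gb, e_beta, e_bc_ac, e_bc_gb, e_ac_gb, e_bc_ac_gb, e_bc_gc, e_bc_ab, e_gc_ab,
    e_bc_gc_ab]

/-! ### The leaf identification: forcing the pendant edge `{b,u}` turns the law of `(a,b,c,y)` into the law of `(a,u,c,y)` -/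

section LeafGlue

variable {D K : Finset (Sym2 V)} {b u : V} (hb : ∀ e ∈ D ∪ K, b ∉ e) (hub : u ≠ b) {S : Finset (Sym2 V)} (hS : S ⊆ D)
include hb hub hS

/-- With `b` on no edge of `D ∪ K`: after forcing `{b,u}`, `b ~ x` iff `u ~ x` before (`x ≠ b`). [folklore] -/
theorem leaf_R_left {x : V} (hx : x ≠ b) : R (insert s(b, u) K) S b x ↔ R K S u x := by
  constructor
  · intro h
    rcases reach_insert_cases h with h | ⟨_, h⟩ | ⟨h, _⟩
    · exact absurd (eq_of_R_of_avoids hS hb h) hx.symm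
    · exact h
    · exact absurd (eq_of_R_of_avoids hS hb h) hub.symm
  · intro h
    exact (R_insert_edge hub.symm).trans (R_mono_insert _ h)

/-- Symmetric form: `x ~ b` iff `x ~ u` before (`x ≠ b`). [folklore] -/
theorem leaf_R_right {x : V} (hx : x ≠ b) : R (insert s(b, u) K) S x b ↔ R K S x u :=
  ⟨fun h => ((leaf_R_left hb hub hS hx).1 h.symm).symm, fun h => ((leaf_R_left hb hub hS hx).2 h.symm).symm⟩

omit hub in
/-- With `b` on no edge of `D ∪ K`: forcing `{b,u}` does not change connections among vertices `≠ b`. [folklore] -/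
theorem leaf_R_other {x z : V} (hx : x ≠ b) (hz : z ≠ b) : R (insert s(b, u) K) S x z ↔ R K S x z := by
  constructor
  · intro h
    rcases reach_insert_cases h with h | ⟨h, _⟩ | ⟨_, h⟩
    · exact h
    · exact absurd (eq_of_R_of_avoids hS hb h.symm) hx.symm
    · exact absurd (eq_of_R_of_avoids hS hb h) hz.symm
  · exact fun h => R_mono_insert _ h

end LeafGlue

/-- **Leaf identification.**  If `b` lies on no edge of `D ∪ K`, `u ≠ b` and `a, c, y ≠ b`, then forcing the edge `{b,u}` makes the masses of
`(a,b,c,y)` equal to the masses of `(a,u,c,y)` under `K`: `massesW D p (K ∪ {{b,u}}) a b c y = massesW D p K a u c y`. [folklore] -/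
theorem massesW_leaf_glue (D : Finset (Sym2 V)) (p : Sym2 V → ℝ) {K : Finset (Sym2 V)} {a b c y u : V}
    (hb : ∀ e ∈ D ∪ K, b ∉ e) (hub : u ≠ b) (hab : a ≠ b) (hcb : c ≠ b) (hyb : y ≠ b) :
    massesW D p (insert s(b, u) K) a b c y = massesW D p K a u c y := by
  have E : ∀ (X Y : Set (Finset (Sym2 V))), (∀ S, S ⊆ D → (S ∈ X ↔ S ∈ Y)) → PrW D p X = PrW D p Y := fun X Y h =>
    PrW_of_ind_eq D p fun S hS => by
      by_cases hm : S ∈ X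
      · rw [ind_of_mem hm, ind_of_mem ((h S hS).1 hm)]
      · rw [ind_of_not_mem hm, ind_of_not_mem (fun h' => hm ((h S hS).2 h'))]
  have lbc : ∀ S, S ⊆ D → (R (insert s(b, u) K) S b c ↔ R K S u c) := fun S hS => leaf_R_left hb hub hS hcb
  have lby : ∀ S, S ⊆ D → (R (insert s(b, u) K) S b y ↔ R K S u y) := fun S hS => leaf_R_left hb hub hS hyb
  have lab : ∀ S, S ⊆ D → (R (insert s(b, u) K) S a b ↔ R K S a u) := fun S hS => leaf_R_right hb hub hS hab
  have lac : ∀ S, S ⊆ D → (R (insert s(b, u) K) S a c ↔ R K S a c) := fun S hS => leaf_R_other hb hS hab hcb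
  have lcy : ∀ S, S ⊆ D → (R (insert s(b, u) K) S c y ↔ R K S c y) := fun S hS => leaf_R_other hb hS hcb hyb
  simp only [massesW]
  congr 1
  · exact E _ _ fun S hS => by simp only [mem_sep, lbc S hS]
  · exact E _ _ fun S hS => by simp only [mem_sep, lac S hS]
  · exact E _ _ fun S hS => by simp only [mem_sep, lab S hS]
  · exact E _ _ fun S hS => by simp only [Set.mem_inter_iff, mem_sep, lab S hS, lby S hS]
  · exact E _ _ fun S hS => by simp only [Set.mem_inter_iff, mem_sep, lac S hS, lcy S hS]
  · exact E _ _ fun S hS => by simp only [mem_cellA, lab S hS, lbc S hS, lby S hS]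
  · exact E _ _ fun S hS => by simp only [Set.mem_inter_iff, mem_sep, lbc S hS, lac S hS]
  · exact E _ _ fun S hS => by simp only [Set.mem_inter_iff, mem_sep, lbc S hS, lab S hS, lby S hS]
  · exact E _ _ fun S hS => by simp only [Set.mem_inter_iff, mem_sep, lac S hS, lab S hS, lby S hS]
  · exact E _ _ fun S hS => by simp only [Set.mem_inter_iff, mem_sep, lbc S hS, lac S hS, lab S hS, lby S hS]
  · exact E _ _ fun S hS => by simp only [Set.mem_inter_iff, mem_sep, lbc S hS, lac S hS, lcy S hS]
  · exact E _ _ fun S hS => by simp only [Set.mem_inter_iff, mem_sep, lbc S hS, lab S hS]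
  · exact E _ _ fun S hS => by simp only [Set.mem_inter_iff, mem_sep, lac S hS, lcy S hS, lab S hS]
  · exact E _ _ fun S hS => by simp only [Set.mem_inter_iff, mem_sep, lbc S hS, lac S hS, lcy S hS, lab S hS]

/-- **The pendant-`b` step at graph level (one leaf, conditional on the two Harris inequalities).**  If `b` lies on no edge of `D ∪ K`,
`e = {b,u} ∉ D`, `u, a, c, y ≠ b`, the Harris inequalities hold for the pairs `(D[a|c], D[b|acy])`, `(D[b|ac], D[c|ay])` of the law of
`(a,u,c,y)` under `(D, K)` (read with `u` for `b`), and (L1) holds for `(a,u,c,y)` under `(D,K)`, then (L1) holds for `(a,b,c,y)` under `(D ∪ {e}, K)`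
for every weight `p e ∈ [0,1]`. [folklore] -/
theorem l1W_leaf_step (D : Finset (Sym2 V)) {p : Sym2 V → ℝ} {K : Finset (Sym2 V)} {a b c y u : V}
    (hb : ∀ e ∈ D ∪ K, b ∉ e) (hub : u ≠ b) (hab : a ≠ b) (hcb : c ≠ b) (hyb : y ≠ b) (he : s(b, u) ∉ D)
    (hp0 : 0 ≤ p s(b, u)) (hp1 : p s(b, u) ≤ 1)
    (hH1 : (massesW D p K a u c y).ac * (massesW D p K a u c y).bc_gb ≤ (massesW D p K a u c y).bc_ac_gb)
    (hH2 : (massesW D p K a u c y).bc_ab * (massesW D p K a u c y).gc ≤ (massesW D p K a u c y).bc_gc_ab)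
    (hL : 0 ≤ l1W D p K a u c y) :
    0 ≤ l1W (insert s(b, u) D) p K a b c y := by
  unfold l1W
  rw [massesW_insert D p K a b c y he, massesW_leaf_glue D p hb hub hab hcb hyb]
  have hDb : ∀ e ∈ D ∪ K, b ∉ e := hb
  have iso : massesW D p K a b c y = HybMasses.isoB (massesW D p K a u c y) := by
    rw [massesW_isoB D p K hDb hab.symm hcb.symm hyb.symm]
    -- `isoB` only reads the fields `ac`, `gc`, which agree for `(a,b,c,y)` and `(a,u,c,y)` (they do not involve the second point)
    rfl
  rw [iso]
  exact HybMasses.L1_mix_isoB_nonneg (massesW_R1 D p K a u c y) (massesW_R2 D p K a u c y) hH1 hH2 hL hp0 hp1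

end CubicFourPointL1

end Summit.CriticalPhenomena.PercolationContinuityZ3.Theorems
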